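import Mathlib
import HarnessLib
import Summits.ResolutionOfSingularities.ResolutionOfSingularities.Theorems.WildQuotientsWildQuotientResolutionConductorOneLaw

/-!
# S2 F8 preliminaries: the conductor-𝟙 core as a G2 base (finite type, positive dimension, faithful action)
(crux stmt-ResolutionOfSingularities-15640 `WildQuotients.WildQuotientResolution`, line `Sketch`; chain w45c
post-V5 programme S2, scaffold F8 (`L/res-L1-w45c-lead-1/S2-DESIGN.md` §5; SIG pin
`L/res-L1-w45c-lead-1/stubs/ConductorOneF8Sig.lean`). [OURS · L1 W4.5c] — NOT a statement of the manuscript.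
Lead prover res-L1-w45c-lead-1.)

The instance-level inputs of G2 `AffineQuotient.hasResolution_spec_fixedPoints_of_model` for
`B = CoreRing k p n`, `G = ⟨σ⟩`:
* `ConductorOne.core_finiteType` — `CoreRing k p n` is of finite type over `k`;
* `ConductorOne.not_isUnit_coreU`, `ConductorOne.core_not_krullDim_le_zero` — `dim Spec (CoreRing) > 0` (`n ≥ 1`:
  `uᵢ` is a non-zero non-unit of the domain `CoreRing`, so `⊥` is a non-maximal prime);
* `ConductorOne.faithfulSMul_zpowers` — a subgroup of `k`-algebra automorphisms acts faithfully.
-/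

-- single-problem summit: the doubled namespace component `ResolutionOfSingularities` is forced
set_option linter.dupNamespace false

noncomputable section

open MvPolynomial AlgebraicGeometry

namespace Summit.ResolutionOfSingularities.ResolutionOfSingularities.Theorems.WildQuotientResolution.ConductorOne

variable (k : Type) [Field k] (p n : ℕ)

/-- `CoreRing k p n` is a finite-type `k`-algebra (a localisation of `k[u]` at one element). [folklore] -/
theorem core_finiteType : Algebra.FiniteType k (CoreRing k p n) := by
  unfold CoreRing Localization.Away
  infer_instance

/-- `uᵢ` is not a unit of the core ring (evaluate a würfel identity `uᵢ b = Dₙ^m` at `u = 0`). [OURS · L1 W4.5c] -/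
theorem not_isUnit_coreU [Fact p.Prime] (i : Fin n) : ¬ IsUnit (coreU k p n i) := by
  intro hu
  obtain ⟨v, hv⟩ := hu.exists_right_inv
  -- write `v = b / Dₙ^m`
  obtain ⟨⟨b, ⟨_, ⟨m, rfl⟩⟩⟩, hbv⟩ :=
    IsLocalization.surj (Submonoid.powers (coreDenominator k p n)) v
  simp only at hbv
  -- `uᵢ b = Dₙ^m` in `k[u]`
  have h1 : algebraMap (MvPolynomial (Fin n) k) (CoreRing k p n) (X i * b) =
      algebraMap (MvPolynomial (Fin n) k) (CoreRing k p n) (coreDenominator k p n ^ m) := by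
    rw [map_mul, ← hbv, ← mul_assoc, map_pow]
    change coreU k p n i * v * _ = _
    rw [hv, one_mul]
  have h2 := algebraMap_coreRing_injective k p n h1
  have hp : p - 1 ≠ 0 := by have := (Fact.out : p.Prime).two_le; omega
  have h3 := congrArg (MvPolynomial.eval (fun _ : Fin n => (0 : k))) h2
  have hD : MvPolynomial.eval (fun _ : Fin n => (0 : k)) (coreDenominator k p n) = 1 := by
    change MvPolynomial.eval (fun _ : Fin n => (0 : k))
      (∏ i : Fin n, ((1 : MvPolynomial (Fin n) k) - X i ^ (p - 1))) = 1
    rw [map_prod]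
    refine Finset.prod_eq_one fun i _ => ?_
    rw [map_sub, map_one, map_pow, eval_X, zero_pow hp, sub_zero]
  rw [map_mul, eval_X, zero_mul, map_pow, hD, one_pow] at h3
  exact zero_ne_one h3

/-- **`dim Spec (CoreRing k p n) > 0`** for `n ≥ 1`. [OURS · L1 W4.5c] -/
theorem core_not_krullDim_le_zero [Fact p.Prime] (hn : 1 ≤ n) :
    ¬ topologicalKrullDim (Spec (CommRingCat.of (CoreRing k p n))) ≤ 0 := by
  haveI := coreRing_isDomain k p n
  intro h
  change topologicalKrullDim (PrimeSpectrum (CoreRing k p n)) ≤ 0 at h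
  rw [PrimeSpectrum.topologicalKrullDim_eq_ringKrullDim] at h
  have h0 : Ring.KrullDimLE 0 (CoreRing k p n) := Ring.krullDimLE_iff.mpr (by exact_mod_cast h)
  have hmax : (⊥ : Ideal (CoreRing k p n)).IsMaximal :=
    (Ring.krullDimLE_zero_iff.mp h0) ⊥ Ideal.isPrime_bot
  -- then every non-zero element is a unit; `u_i` is not
  let i : Fin n := ⟨0, hn⟩
  have hne : ¬ Ideal.span {coreU k p n i} = ⊤ := fun htop =>
    not_isUnit_coreU k p n i (Ideal.span_singleton_eq_top.mp htop)
  have hbot : (⊥ : Ideal (CoreRing k p n)) = Ideal.span {coreU k p n i} := hmax.eq_of_le hne bot_le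
  have : coreU k p n i ∈ (⊥ : Ideal (CoreRing k p n)) := by rw [hbot]; exact Ideal.mem_span_singleton_self _
  exact coreU_ne_zero k p n i (Ideal.mem_bot.mp this)

/-- A subgroup of `k`-algebra automorphisms acts faithfully. [folklore] -/
theorem faithfulSMul_zpowers (σ : CoreRing k p n ≃ₐ[k] CoreRing k p n) :
    FaithfulSMul ↥(Subgroup.zpowers σ) (CoreRing k p n) := by
  refine ⟨fun {g h} hgh => ?_⟩
  apply Subtype.ext
  exact AlgEquiv.ext fun x => hgh x

end Summit.ResolutionOfSingularities.ResolutionOfSingularities.Theorems.WildQuotientResolution.ConductorOne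

end
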